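import Literature.AlgebraicGeometry.Resolution.BlowupSNC
import Literature.AlgebraicGeometry.Resolution.KollarCoverTriples
import HarnessLib

/-!
# Strict transforms of distinct boundary divisors stay distinct (Kollár 2007, Notation 3.64 (3) along Def. 3.66)

Topic: `Literature/AlgebraicGeometry/Resolution`. Shared infrastructure for the decomposition of
the named facts `Kollar2007Thm3_103` / `Kollar2007Thm3_107` (`KollarBlowupSequenceFunctors.lean`;
J. Kollár, *Lectures on Resolution of Singularities*, 2007, Ch. 3). Kollár's triples `(X, I, E)`
(Notation 3.64) carry an ORDERED boundary `E = (E^1, …, E^s)` of smooth divisors, "each allowed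
to be reducible or empty", in which two members coincide only if empty (Def. 3.24 (3): distinct
divisors through a point have distinct local equations; the field `boundary_pairwise` of
`Kollar2007.Triple`). Along a smooth blow-up the boundary becomes the strict (birational)
transforms of the old members followed by the exceptional divisor (Def. 3.65,
`MarkedIdeal.transform`). This file PROVES that the "no repeated non-empty member" condition
survives (`pairwise_transform_boundary`), from two facts about the strict transform
`⋃ₙ (π^*K : 𝓘(D)ⁿ)` (`strictTransformIdeal`, GW (13.19)) of independent use:

* `strictTransformIdeal_eq_top_of_support_subset` — **a strict transform supported on the
  exceptional divisor is trivial**: the strict transform is saturated with respect to `𝓘(D)`,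
  and `V(S) ⊆ D` gives `𝓘(D) ⊆ √S` by the scheme-theoretic Nullstellensatz
  (`Scheme.IdealSheafData.vanishingIdeal_support`), so `𝓘(D)ᴺ ⊆ S` stalkwise and `1 ∈ S`;
* `stalkIdeal_strictTransformIdeal_of_not_mem` — off the exceptional divisor the strict
  transform is the total transform `K_{πx'}·𝒪_{X',x'}`; `IsBlowup.isIso_stalkMap_of_not_mem_exceptional` —
  there the stalk maps of the blow-up are isomorphisms (Stacks 02OS);
* `strictTransformIdeal_eq_top_of_eq_of_ne` — distinct members of an snc boundary with equal
  strict transforms have trivial strict transform (their stalks differ wherever both pass,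
  `HasSNCWith.stalkIdeal_ne_of_ne` of `KollarCoverTriples.lean`); `strictTransformIdeal_top`;
* **`pairwise_transform_boundary`** — the transformed boundary
  `E.map (strictTransformIdeal π C) ++ [𝓘(D)]` is pairwise distinct unless empty.

## Sources

* J. Kollár, *Lectures on Resolution of Singularities* (2007): Def. 3.24 (3) (p. 125),
  Notation 3.64 (3) (p. 148), Def. 3.65–3.66 (p. 149). [Kollar2007]
* U. Görtz, T. Wedhorn, *Algebraic Geometry I*, 2nd ed. (2020), (13.19) (strict transform).
  [GortzWedhorn2020]
* The Stacks Project, Tag 02OS. [StacksProject]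
-/

noncomputable section

open CategoryTheory CategoryTheory.Limits AlgebraicGeometry TopologicalSpace IsLocalRing

namespace Literature.AlgebraicGeometry.Resolution

universe u

variable {X X' : Scheme.{u}} [IsLocallyNoetherian X] [IsLocallyNoetherian X'] (π : X' ⟶ X)
  (C : X.IdealSheafData)

/-- The stalk of the radical is contained in the radical of the stalk. [folklore] -/
theorem stalkIdeal_radical_le {Y : Scheme.{u}} (I : Y.IdealSheafData) (y : Y) :
    stalkIdeal I.radical y ≤ (stalkIdeal I y).radical := by
  obtain ⟨U, hU, hyU, -⟩ :=
    exists_isAffineOpen_mem_and_subset (X := Y) (x := y) (U := ⊤) (Opens.mem_top y)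
  rw [stalkIdeal_eq_map_germ _ ⟨U, hU⟩ hyU, stalkIdeal_eq_map_germ _ ⟨U, hU⟩ hyU,
    Scheme.IdealSheafData.radical_ideal]
  exact Ideal.map_radical_le _

omit [IsLocallyNoetherian X] in
/-- **A strict transform supported on the exceptional divisor is trivial**: the strict transform
`S = ⋃ₙ (π^*K : 𝓘(D)ⁿ)` is saturated with respect to the exceptional ideal `𝓘(D)`, so if
`V(S) ⊆ D` then `𝓘(D) ⊆ √S` (scheme-theoretic Nullstellensatz,
`Scheme.IdealSheafData.vanishingIdeal_support`), `𝓘(D)ᴺ ⊆ S` stalkwise, and `1 ∈ (S : 𝓘(D)ᴺ) = S`.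
[folklore] -/
theorem strictTransformIdeal_eq_top_of_support_subset (K : X.IdealSheafData)
    (h : ((strictTransformIdeal π C K).support : Set X') ⊆ (C.comap π).support) :
    strictTransformIdeal π C K = ⊤ := by
  set S := strictTransformIdeal π C K with hSdef
  set F := C.comap π with hFdef
  -- `F ≤ √S`
  have hFS : F ≤ S.radical := by
    rw [← Scheme.IdealSheafData.vanishingIdeal_support]
    refine le_trans ?_ (Scheme.IdealSheafData.vanishingIdeal_antimono (show S.support ≤ F.support from h))
    exact Scheme.IdealSheafData.le_support_iff_le_vanishingIdeal.mp le_rfl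
  -- it suffices to show that every stalk of `S` is the unit ideal
  rw [← Scheme.IdealSheafData.support_eq_bot_iff, ← le_bot_iff]
  intro x' hx'
  exfalso
  rw [mem_support_iff_stalkIdeal_le] at hx'
  apply (IsLocalRing.maximalIdeal.isMaximal (X'.presheaf.stalk x')).ne_top
  rw [eq_top_iff]
  refine le_trans ?_ hx'
  -- `F_{x'}ᴺ ⊆ S_{x'}` for some `N`
  haveI : IsNoetherianRing (X'.presheaf.stalk x') := inferInstance
  have hfg : (stalkIdeal F x').FG := IsNoetherian.noetherian _
  have hle : stalkIdeal F x' ≤ (stalkIdeal S x').radical :=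
    (stalkIdeal_mono hFS x').trans (stalkIdeal_radical_le S x')
  obtain ⟨N, hN⟩ := Ideal.exists_pow_le_of_le_radical_of_fg hle hfg
  -- saturation: `S_{x'} = ⋃ₙ (K' : F_{x'}ⁿ)` and `F_{x'}ᴺ ⊆ S_{x'}` give `1 ∈ S_{x'}`
  have hS : stalkIdeal S x' = ⨆ n : ℕ, Submodule.colon ((stalkIdeal K (π x')).map (π.stalkMap x').hom)
      ((stalkIdeal F x' ^ n : Ideal _) : Set (X'.presheaf.stalk x')) :=
    stalkIdeal_strictTransformIdeal π C K x'
  -- the family is monotone, `F_{x'}ᴺ` is finitely generated, hence lies in one member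
  set K' := (stalkIdeal K (π x')).map (π.stalkMap x').hom with hK'def
  have hmono : Monotone fun n : ℕ =>
      Submodule.colon K' ((stalkIdeal F x' ^ n : Ideal _) : Set (X'.presheaf.stalk x')) := by
    intro a b hab z hz
    rw [Submodule.mem_colon] at hz ⊢
    intro p hp
    exact hz p (Ideal.pow_le_pow_right hab hp)
  have hfgN : (stalkIdeal F x' ^ N).FG := IsNoetherian.noetherian _
  rw [hS] at hN
  obtain ⟨M, hM⟩ : ∃ M : ℕ, stalkIdeal F x' ^ N ≤
      Submodule.colon K' ((stalkIdeal F x' ^ M : Ideal _) : Set (X'.presheaf.stalk x')) := by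
    obtain ⟨s, hs⟩ := hfgN
    have key : ∀ z ∈ (s : Set (X'.presheaf.stalk x')), ∃ M : ℕ,
        z ∈ Submodule.colon K' ((stalkIdeal F x' ^ M : Ideal _) : Set (X'.presheaf.stalk x')) := by
      intro z hz
      have hz' : z ∈ stalkIdeal F x' ^ N := hs ▸ Ideal.subset_span hz
      have := hN hz'
      exact (Submodule.mem_iSup_of_directed _ hmono.directed_le).mp this
    choose! Mz hMz using key
    refine ⟨s.sup Mz, ?_⟩
    rw [← hs, Ideal.span_le]
    intro z hz
    exact hmono (Finset.le_sup hz) (hMz z hz)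
  -- then `F^{M} · F^{N} ⊆ K'`, i.e. `1 ∈ (K' : F^{M+N}) ⊆ S_{x'}`
  rw [hS, top_le_iff, Ideal.eq_top_iff_one]
  refine (Submodule.mem_iSup_of_directed _ hmono.directed_le).mpr ⟨M + N, ?_⟩
  rw [Submodule.mem_colon]
  intro p hp
  rw [pow_add] at hp
  simp only [smul_eq_mul, one_mul]
  refine Submodule.mul_induction_on hp (fun a ha b hb => ?_) (fun a b ha hb => Submodule.add_mem _ ha hb)
  have hb' := hM hb
  rw [Submodule.mem_colon] at hb'
  have := hb' a ha
  simpa [smul_eq_mul, mul_comm] using this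

omit [IsLocallyNoetherian X] in
/-- **Off the exceptional divisor the strict transform is the total transform**: at a point
`x' ∉ D`, `(strict transform of V(K))_{x'} = K_{π x'} · 𝒪_{X', x'}`. [folklore] -/
theorem stalkIdeal_strictTransformIdeal_of_not_mem (K : X.IdealSheafData) {x' : X'}
    (hx' : x' ∉ (C.comap π).support) :
    stalkIdeal (strictTransformIdeal π C K) x' = (stalkIdeal K (π x')).map (π.stalkMap x').hom := by
  rw [stalkIdeal_strictTransformIdeal, stalkIdeal_eq_top_of_not_mem_support hx']
  have hcol : ∀ n : ℕ, Submodule.colon ((stalkIdeal K (π x')).map (π.stalkMap x').hom)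
      (((⊤ : Ideal (X'.presheaf.stalk x')) ^ n : Ideal _) : Set (X'.presheaf.stalk x')) =
      (stalkIdeal K (π x')).map (π.stalkMap x').hom := by
    intro n
    rw [Ideal.top_pow]
    ext z
    rw [Submodule.mem_colon]
    constructor
    · intro hz
      simpa using hz 1 trivial
    · intro hz p _
      exact Ideal.mul_mem_right p _ hz
  simp_rw [hcol]
  exact iSup_const


omit [IsLocallyNoetherian X] [IsLocallyNoetherian X'] in
/-- Over the complement of the centre the stalk maps of a blow-up are isomorphisms (the
blow-up is an isomorphism there, Stacks 02OS). [cite: StacksProject, Tag 02OS] -/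
theorem IsBlowup.isIso_stalkMap_of_not_mem_exceptional {π : X' ⟶ X} {C : X.IdealSheafData}
    (hπ : IsBlowup π C) {x' : X'} (hx' : x' ∉ (C.comap π).support) : IsIso (π.stalkMap x') := by
  set U : X.Opens := ⟨(C.support : Set X)ᶜ, C.support.isClosed.isOpen_compl⟩ with hUdef
  haveI : IsIso (π ∣_ U) := hπ.isIso_compl
  have hxU : x' ∈ π ⁻¹ᵁ U := by
    intro h
    apply hx'
    show x' ∈ ((C.comap π).support : Set X')
    rw [Scheme.IdealSheafData.support_comap]
    exact h
  exact ((MorphismProperty.isomorphisms CommRingCat).arrow_mk_iso_iff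
    (morphismRestrictStalkMap π U ⟨x', hxU⟩)).mp
    ((MorphismProperty.isomorphisms.iff _).mpr inferInstance)

omit [IsLocallyNoetherian X] in
/-- **Strict transforms of distinct divisors of an snc boundary coincide only when empty**:
if `D ≠ D'` are members of `E` (with `HasSNCWith E C`) whose strict transforms under the blow-up
along `C` are equal, that strict transform is the unit ideal. Off the exceptional divisor the
strict transforms are the pulled-back stalks `D_{πx'}·𝒪`, `D'_{πx'}·𝒪` along the isomorphic
stalk maps, which differ wherever both divisors pass (`HasSNCWith.stalkIdeal_ne_of_ne`); so the
common strict transform is supported on the exceptional divisor, hence trivial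
(`strictTransformIdeal_eq_top_of_support_subset`). [folklore] -/
theorem strictTransformIdeal_eq_top_of_eq_of_ne {π : X' ⟶ X} {C : X.IdealSheafData}
    (hπ : IsBlowup π C) {E : List X.IdealSheafData} (hE : HasSNCWith E C)
    {D D' : X.IdealSheafData} (hD : D ∈ E) (hD' : D' ∈ E) (hne : D ≠ D')
    (heq : strictTransformIdeal π C D = strictTransformIdeal π C D') :
    strictTransformIdeal π C D = ⊤ := by
  refine strictTransformIdeal_eq_top_of_support_subset π C D fun x' hx'S => ?_
  by_contra hx'F
  haveI := hπ.isIso_stalkMap_of_not_mem_exceptional hx'F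
  have hbij : Function.Bijective (π.stalkMap x').hom :=
    ConcreteCategory.bijective_of_isIso (π.stalkMap x')
  have h1 := stalkIdeal_strictTransformIdeal_of_not_mem π C D hx'F
  have h2 := stalkIdeal_strictTransformIdeal_of_not_mem π C D' hx'F
  -- both divisors pass through `π x'`
  have hxS : stalkIdeal (strictTransformIdeal π C D) x' ≠ ⊤ := by
    intro htop
    rw [SetLike.mem_coe, mem_support_iff_stalkIdeal_le, htop, top_le_iff] at hx'S
    exact (IsLocalRing.maximalIdeal.isMaximal _).ne_top hx'S
  have hx : π x' ∈ D.support := by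
    by_contra h
    exact hxS (by rw [h1, stalkIdeal_eq_top_of_not_mem_support h, Ideal.map_top])
  have hx2 : π x' ∈ D'.support := by
    by_contra h
    exact hxS (by rw [heq, h2, stalkIdeal_eq_top_of_not_mem_support h, Ideal.map_top])
  refine hE.stalkIdeal_ne_of_ne hD hD' hne hx hx2 ?_
  have key : (stalkIdeal D (π x')).map (π.stalkMap x').hom =
      (stalkIdeal D' (π x')).map (π.stalkMap x').hom := by
    rw [← h1, ← h2, heq]
  calc stalkIdeal D (π x')
      = ((stalkIdeal D (π x')).map (π.stalkMap x').hom).comap (π.stalkMap x').hom :=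
        (Ideal.comap_map_of_bijective _ hbij).symm
    _ = ((stalkIdeal D' (π x')).map (π.stalkMap x').hom).comap (π.stalkMap x').hom := by rw [key]
    _ = stalkIdeal D' (π x') := Ideal.comap_map_of_bijective _ hbij

omit [IsLocallyNoetherian X] [IsLocallyNoetherian X'] in
/-- The strict transform of the empty divisor is empty. [folklore] -/
theorem strictTransformIdeal_top (π : X' ⟶ X) (C : X.IdealSheafData) :
    strictTransformIdeal π C ⊤ = ⊤ := by
  rw [eq_top_iff]
  calc (⊤ : X'.IdealSheafData) = (⊤ : X.IdealSheafData).comap π := (Scheme.IdealSheafData.comap_top _).symm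
    _ ≤ controlledTransform π C ⊤ 1 := comap_le_controlledTransform π C ⊤ 1
    _ ≤ strictTransformIdeal π C ⊤ := controlledTransform_le_strictTransformIdeal π C ⊤ 1

omit [IsLocallyNoetherian X] in
/-- **The transformed boundary has no repeated non-empty member** (the field
`boundary_pairwise` of `Kollar2007.Triple` for `(X_{i+1}, I_{i+1}, E_{i+1})`): the strict
transforms of the old divisors followed by the exceptional divisor are pairwise distinct unless
empty, provided the old boundary was and had simple normal crossings with the centre.
[cite: Kollar2007, Notation 3.64 (3) (p. 148) with Def. 3.24 (3) (p. 125)] -/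
theorem pairwise_transform_boundary {π : X' ⟶ X} {C : X.IdealSheafData} (hπ : IsBlowup π C)
    {E : List X.IdealSheafData} (hE : HasSNCWith E C)
    (hp : E.Pairwise fun D D' => D = D' → D = ⊤) :
    (E.map (strictTransformIdeal π C) ++ [C.comap π]).Pairwise fun D D' => D = D' → D = ⊤ := by
  rw [List.pairwise_append]
  refine ⟨?_, List.pairwise_singleton _ _, ?_⟩
  · rw [List.pairwise_map]
    refine hp.imp_of_mem ?_
    intro D D' hD hD' hDD' heq
    by_cases hne : D = D'
    · rw [hDD' hne, strictTransformIdeal_top]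
    · exact strictTransformIdeal_eq_top_of_eq_of_ne hπ hE hD hD' hne heq
  · intro S hS F' hF' hSF
    rw [List.mem_singleton] at hF'
    subst hF'
    obtain ⟨D, -, rfl⟩ := List.mem_map.mp hS
    exact strictTransformIdeal_eq_top_of_support_subset π C D (by rw [hSF])

end Literature.AlgebraicGeometry.Resolution

end
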